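import Summits.BirchSwinnertonDyer.BirchSwinnertonDyer.Theorems.ThetaPartnerAtTwoSignedKatoUpToAtTwoIwasawaH1Twist
import Literature.NumberTheory.EllipticCurves.Kato2004.EulerSystemBoundFineSelmerTwo
import HarnessLib

/-!
# Route `ThetaPartnerAtTwo` (TP2), crux K3 `SignedKatoDivisibilityUpToAtTwo` (item stmt-BirchSwinnertonDyer-20308),
# line `colemanrat` v5 — THE THIRD PRINT-EXACT SPELLING OF KATO Thm. 13.4 (2) AT `p = 2` («twist `𝐇¹`»:
# `I : IwasawaH1Data W 2 κ γ⁻¹` against the tree's fine dual `Y : FineSelmerDualData κ γ`, SAME prime) ⟺ (K2^ι)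

Width seat `bsd-wall-tp2-p2x-w3` g3 (cell `bsd-wall`). HONEST FRAMING: THEOREMS ONLY — no definition, no named fact, no
instance, no `sorry`; route-independent (statements written out verbatim); Kato's theorem is NOT proved (both sides are
hypotheses); closes no item; BSD is NOT proved by any of this.

## Why this file

Companion of `…KatoBoundTwist` ((K2′) «contragredient fine dual» ⟺ (K2^ι) = stub `stub_katoBoundTwoInv`). The convention audit's
remaining print-exact spelling twists the COVARIANT side instead: Kato's `𝐇¹` with `T = conj_{γ⁻¹} − 1`
(`I : Kato2004.IwasawaH1Data W 2 κ γ⁻¹`, the `ι`-twist of print's `𝐇¹` when `γ` is the chosen generator) against the tree's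
fine dual over `γ` (the `ι`-twist of print's `X₀`) AT THE SAME PRIME — «Kato ∘ ι on both sides = Kato». With the `𝐇¹`-twist
`IwasawaInvolution.exists_twist_iwasawaH1Data_invol` (`…IwasawaH1Twist`: same group, same layer projections — so the GENUINE
Euler-system-class clause `IsEulerSystemClassTwo`, which reads only `proj`, transfers verbatim — and
`ℓ_{ι𝔓}(I.H ⧸ Λs) = ℓ_𝔓(I′.H ⧸ Λ(e s))`) this spelling (K2″) is KERNEL-EQUIVALENT to (K2^ι):
`katoBoundTwoInv_of_h1Contra`, `h1Contra_of_katoBoundTwoInv`. Hence all three print-exact spellings (K2′), (K2″), (K2^ι) are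
interchangeable; a typer may retype the Literature fact in whichever is most convenient (K2″ keeps BOTH dual data in the tree's
`γ`-convention and makes the Poitou–Tate map into `D.X` `Λ`-LINEAR from the twisted `𝐇¹`).

References: [Kato2004Asterisque, Thm. 13.4 (2) (p. 226), §12.2, §13.1]; [GreenbergLNM1716, §1 p. 60]; [PerrinRiou1994, §1.3].
-/

set_option autoImplicit false
-- the Theorems namespace of this sub repeats the summit name by design (D-0017 nested layout)
set_option linter.dupNamespace false

noncomputable section

open scoped Classical NumberField

namespace Summit.BirchSwinnertonDyer.BirchSwinnertonDyer.Theorems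

namespace SignedKatoOffTwo.IwasawaInvolution

open Field IsDedekindDomain Literature.NumberTheory.GaloisRepresentations Literature.NumberTheory.EllipticCurves
  Literature.NumberTheory.EllipticCurves.Module Literature.NumberTheory.EllipticCurves.Kato2004
  Literature.NumberTheory.EllipticCurves.Kato2004.EulerSystemValues ZpExtension

/-- **(K2″) ⟹ (K2^ι).** From Kato 13.4 (2) at `2` read with the TWISTED `𝐇¹` (`I : IwasawaH1Data W 2 κ γ⁻¹`) against the tree's
fine dual over `γ` at the same prime (`IsEulerSystemClassTwo` folded), to the registered stub `stub_katoBoundTwoInv` VERBATIM.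
Proof: twist `I ↦ I′` over `γ⁻¹` (`e` preserves `proj`, so `e s` is again a genuine Euler-system class),
`ℓ_{ι𝔭}(I.H ⧸ Λs) = ℓ_𝔭(I′.H ⧸ Λ(e s))`. [cite: Kato2004Asterisque, Thm. 13.4 (2) (p. 226)] [cite: GreenbergLNM1716, §1 p. 60] -/
theorem katoBoundTwoInv_of_h1Contra
    (hK2 : ∀ (W : WeierstrassCurve ℚ) [W.IsElliptic], ¬ W.HasCM →
      ∀ [ContinuousSMul ℤ_[2] (W.tateModule 2)] [Module.Free ℤ_[2] (W.tateModule 2)]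
        [Module.Finite ℤ_[2] (W.tateModule 2)]
        (κ : ZpExtension ℚ 2) (γ : absoluteGaloisGroup ℚ) (hκ : κ.IsCyclotomic), κ.IsTopGenerator γ →
      ∀ (I : IwasawaH1Data W 2 κ γ⁻¹) (FB : W.FineSelmerDualData κ γ) (s : I.H),
        IsEulerSystemClassTwo W hκ I s → s ≠ 0 →
        ∀ 𝔭 : PrimeSpectrum (IwasawaAlgebra 2), 𝔭.asIdeal.height = 1 →
          PowerSeries.C (2 : ℤ_[2]) ∉ 𝔭.asIdeal →
            lengthAt (IwasawaAlgebra 2) FB.X 𝔭 ≤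
              lengthAt (IwasawaAlgebra 2) (I.H ⧸ Submodule.span (IwasawaAlgebra 2) {s}) 𝔭) :
    ∀ (W : WeierstrassCurve ℚ) [W.IsElliptic], ¬ W.HasCM →
      ∀ [ContinuousSMul ℤ_[2] (W.tateModule 2)] [Module.Free ℤ_[2] (W.tateModule 2)]
        [Module.Finite ℤ_[2] (W.tateModule 2)]
        (κ : ZpExtension ℚ 2) (γ : Field.absoluteGaloisGroup ℚ) (hκ : κ.IsCyclotomic), κ.IsTopGenerator γ →
      ∀ (I : Kato2004.IwasawaH1Data W 2 κ γ) (Y : W.FineSelmerDualData κ γ) (s : I.H),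
        (∃ (S : Set (HeightOneSpectrum (𝓞 ℚ))) (_ : S.Finite)
            (z : ∀ (k : ℕ) (r : (cyclotomicLevelsRat 2 S).Ideals),
              H1 (tateRep W 2) ((cyclotomicLevelsRat 2 S).level k r.1)),
            IsEulerSystem (cyclotomicLevelsRat 2 S) (tateRep W 2) 2 z ∧
            (∀ (k : ℕ) (r : (cyclotomicLevelsRat 2 S).Ideals),
              z k r ∈ integralH1 (tateRep W 2) 2 ((cyclotomicLevelsRat 2 S).level k r.1)) ∧
            ∀ n : ℕ, I.proj n s =
              Kato2004.levelToLayerTwo W hκ S n (z (n + 2) (cyclotomicLevelsRat 2 S).idealOne)) →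
        s ≠ 0 →
        ∀ 𝔭 : PrimeSpectrum (IwasawaAlgebra 2), 𝔭.asIdeal.height = 1 →
          PowerSeries.C (2 : ℤ_[2]) ∉ 𝔭.asIdeal →
          lengthAt (IwasawaAlgebra 2) Y.X 𝔭 ≤
            lengthAt (IwasawaAlgebra 2) (I.H ⧸ Submodule.span (IwasawaAlgebra 2) {s})
              (PrimeSpectrum.comap (IwasawaAlgebra.invol 2).toRingHom 𝔭) := by
  intro W _ hcm _ _ _ κ γ hκ hγ I Y s hES hs0 𝔭 h𝔭 h2
  obtain ⟨I', e, -, hproj, hlen⟩ := exists_twist_iwasawaH1Data_invol (p := 2) (mul_inv_cancel γ) I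
  obtain ⟨S, hS, z, hz, hint, hlay⟩ := hES
  have hES' : IsEulerSystemClassTwo W hκ I' (e s) :=
    ⟨S, hS, z, hz, hint, fun n ↦ by rw [hproj]; exact hlay n⟩
  have hs0' : e s ≠ 0 := fun h ↦ hs0 (e.injective (by rw [h, map_zero]))
  calc lengthAt (IwasawaAlgebra 2) Y.X 𝔭
      ≤ lengthAt (IwasawaAlgebra 2) (I'.H ⧸ Submodule.span (IwasawaAlgebra 2) {e s}) 𝔭 :=
        hK2 W hcm κ γ hκ hγ I' Y (e s) hES' hs0' 𝔭 h𝔭 h2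
    _ = lengthAt (IwasawaAlgebra 2) (I.H ⧸ Submodule.span (IwasawaAlgebra 2) {s})
          (PrimeSpectrum.comap (IwasawaAlgebra.invol 2).toRingHom 𝔭) := (hlen s 𝔭).symm

/-- **(K2^ι) ⟹ (K2″).** The converse (twist `I ↦ I′` over `γ`, and `ι(ι𝔭) = 𝔭`). [cite: Kato2004Asterisque, Thm. 13.4 (2) (p. 226)]
[cite: GreenbergLNM1716, §1 p. 60] -/
theorem h1Contra_of_katoBoundTwoInv
    (hK2ι : ∀ (W : WeierstrassCurve ℚ) [W.IsElliptic], ¬ W.HasCM →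
      ∀ [ContinuousSMul ℤ_[2] (W.tateModule 2)] [Module.Free ℤ_[2] (W.tateModule 2)]
        [Module.Finite ℤ_[2] (W.tateModule 2)]
        (κ : ZpExtension ℚ 2) (γ : Field.absoluteGaloisGroup ℚ) (hκ : κ.IsCyclotomic), κ.IsTopGenerator γ →
      ∀ (I : Kato2004.IwasawaH1Data W 2 κ γ) (Y : W.FineSelmerDualData κ γ) (s : I.H),
        (∃ (S : Set (HeightOneSpectrum (𝓞 ℚ))) (_ : S.Finite)
            (z : ∀ (k : ℕ) (r : (cyclotomicLevelsRat 2 S).Ideals),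
              H1 (tateRep W 2) ((cyclotomicLevelsRat 2 S).level k r.1)),
            IsEulerSystem (cyclotomicLevelsRat 2 S) (tateRep W 2) 2 z ∧
            (∀ (k : ℕ) (r : (cyclotomicLevelsRat 2 S).Ideals),
              z k r ∈ integralH1 (tateRep W 2) 2 ((cyclotomicLevelsRat 2 S).level k r.1)) ∧
            ∀ n : ℕ, I.proj n s =
              Kato2004.levelToLayerTwo W hκ S n (z (n + 2) (cyclotomicLevelsRat 2 S).idealOne)) →
        s ≠ 0 →
        ∀ 𝔭 : PrimeSpectrum (IwasawaAlgebra 2), 𝔭.asIdeal.height = 1 →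
          PowerSeries.C (2 : ℤ_[2]) ∉ 𝔭.asIdeal →
          lengthAt (IwasawaAlgebra 2) Y.X 𝔭 ≤
            lengthAt (IwasawaAlgebra 2) (I.H ⧸ Submodule.span (IwasawaAlgebra 2) {s})
              (PrimeSpectrum.comap (IwasawaAlgebra.invol 2).toRingHom 𝔭)) :
    ∀ (W : WeierstrassCurve ℚ) [W.IsElliptic], ¬ W.HasCM →
      ∀ [ContinuousSMul ℤ_[2] (W.tateModule 2)] [Module.Free ℤ_[2] (W.tateModule 2)]
        [Module.Finite ℤ_[2] (W.tateModule 2)]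
        (κ : ZpExtension ℚ 2) (γ : absoluteGaloisGroup ℚ) (hκ : κ.IsCyclotomic), κ.IsTopGenerator γ →
      ∀ (I : IwasawaH1Data W 2 κ γ⁻¹) (FB : W.FineSelmerDualData κ γ) (s : I.H),
        IsEulerSystemClassTwo W hκ I s → s ≠ 0 →
        ∀ 𝔭 : PrimeSpectrum (IwasawaAlgebra 2), 𝔭.asIdeal.height = 1 →
          PowerSeries.C (2 : ℤ_[2]) ∉ 𝔭.asIdeal →
            lengthAt (IwasawaAlgebra 2) FB.X 𝔭 ≤
              lengthAt (IwasawaAlgebra 2) (I.H ⧸ Submodule.span (IwasawaAlgebra 2) {s}) 𝔭 := by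
  intro W _ hcm _ _ _ κ γ hκ hγ I FB s hES hs0 𝔭 h𝔭 h2
  obtain ⟨I', e, -, hproj, hlen⟩ := exists_twist_iwasawaH1Data_invol (p := 2) (inv_mul_cancel γ) I
  obtain ⟨S, hS, z, hz, hint, hlay⟩ := hES
  have hES' : IsEulerSystemClassTwo W hκ I' (e s) :=
    ⟨S, hS, z, hz, hint, fun n ↦ by rw [hproj]; exact hlay n⟩
  have hs0' : e s ≠ 0 := fun h ↦ hs0 (e.injective (by rw [h, map_zero]))
  have h𝔭𝔭 : PrimeSpectrum.comap (IwasawaAlgebra.invol 2).toRingHom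
      (PrimeSpectrum.comap (IwasawaAlgebra.invol 2).toRingHom 𝔭) = 𝔭 := comap_invol_comap_invol 2 𝔭
  calc lengthAt (IwasawaAlgebra 2) FB.X 𝔭
      ≤ lengthAt (IwasawaAlgebra 2) (I'.H ⧸ Submodule.span (IwasawaAlgebra 2) {e s})
          (PrimeSpectrum.comap (IwasawaAlgebra.invol 2).toRingHom 𝔭) :=
        hK2ι W hcm κ γ hκ hγ I' FB (e s) ((isEulerSystemClassTwo_iff W hκ I' (e s)).1 hES') hs0' 𝔭 h𝔭 h2
    _ = lengthAt (IwasawaAlgebra 2) (I.H ⧸ Submodule.span (IwasawaAlgebra 2) {s})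
          (PrimeSpectrum.comap (IwasawaAlgebra.invol 2).toRingHom
            (PrimeSpectrum.comap (IwasawaAlgebra.invol 2).toRingHom 𝔭)) :=
        (hlen s (PrimeSpectrum.comap (IwasawaAlgebra.invol 2).toRingHom 𝔭)).symm
    _ = lengthAt (IwasawaAlgebra 2) (I.H ⧸ Submodule.span (IwasawaAlgebra 2) {s}) 𝔭 := by rw [h𝔭𝔭]

end SignedKatoOffTwo.IwasawaInvolution

end Summit.BirchSwinnertonDyer.BirchSwinnertonDyer.Theorems

end
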